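import Summits.HodgeConjecture.HodgeConjecture.Theorems.F0P3FinComponentTokens          -- ★ p821168: `isConstituentOf_comp_inclPlace_subsingleton`, `comap_clFinChoice_isConstituentOf_of_hasFinComponent`; cone: ★ T♭-core, ★ p819116, ★ p819048
import HarnessLib

/-!
# Crux `H413`, floor 0, programme F0P3 — LAW `LocalIsotypyFin` (#22) AT THE KIT OF RECORD `𝔠₀`, REDUCED TO THE FINITE HALF OF `hAF`
# («every discrete automorphic `P` of `U(H)` has an irreducible ADMISSIBLE finite component»)

Cell hodgecm-mathlib (D-0151), sub-cell F0/P3 «U3-mult»; pen F0P3-p02 (g7); crux item stmt-HodgeConjecture-24833 (`HCCMUnconditional.H413`); PLAN.F0P3g5 §1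
row 22 («(L7″) letter + 10-line glue over `clFinChoice` … glue p02»).  PROOF lane (`--kind proof --supports stmt-HodgeConjecture-24833 --as helper`): theorems only;
no `def`, no instance, no notation, no named fact, no `sorry`; kit-free (the law body is spelled at the tokens of record).

THE LAW (dossier `Cruxes/H413/Lines/F0_T5InnerFormClassification.lean` v5 :551, ★ V5-B `ClassificationLawsV5`): `LocalIsotypyFin := ∀ P v c′, (IrrClass.comap
(localPiEquiv … v) c′).IsConstituentOf (P.finRep.smoothPart.toRepresentation.comp (inclPlace … v)) → c′ = clFin (cl P) v` [Flath1979 Thm. 3; BernsteinZelevinsky1976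
2.16; Rogawski1990 §14.5 p. 237]; at `𝔠₀`: `clFin c v := clFinChoice (rep c) v` (★ p819116), `cl ∕ rep` ★ p819048.

THE REDUCTION.  If `P` has an irreducible ADMISSIBLE finite component `σ` (★ `HasFinComponent`; the finite half of the «AutomorphicFlathAdmissible» letter of
RULING (V24)(d2) [Flath1979 Thm. 3; BorelJacquet1979 §4.6]), then so does `rep (cl P) ≃ P` (§1, transport along the unitary equivalence ★ `rep_cl_areUnitarilyEquivalent`),
the constituent classes of `P` at `v` are those of `σ|_v` (★ T♭-core) and form a SINGLETON (★ p821168 `isConstituentOf_comp_inclPlace_subsingleton`), and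
`clFinChoice (rep (cl P)) v`, pulled back along ★ `localPiEquiv v`, is one of them (★ p821168 `comap_clFinChoice_isConstituentOf_of_hasFinComponent`); `IrrClass.comap` along
an isomorphism is injective (★ `IrrClass.comap_symm_comap`).  Hence law #22 at `𝔠₀` follows from `hAF` ALONE — so the #22 letter can be the standard print statement
«irreducible admissible finite component» rather than a bespoke isotypy text (planner's choice; count unchanged).

* §1 `hasFinComponent_of_areUnitarilyEquivalent` (transport of ★ `HasFinComponent` along ★ `AreUnitarilyEquivalent`), `hasFinComponent_rep_cl`.
* §2 `eq_clFinChoice_of_isConstituentOf` (one `P` with an irreducible admissible finite component), **`localIsotypyFin₀_of_hAF`** — law #22 at `𝔠₀`, token for token,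
  from `hAF : ∀ P, ∃ W σ, σ.IsIrreducible ∧ σ.IsAdmissible ∧ P.HasFinComponent σ`.
HONEST LABEL: HC_CM is proved only modulo the printed citations until rung 0 closes; this file discharges none of them (it moves #22 onto `hAF`).
References: D. Flath, PSPM 33.1 (1979), Thm. 3 [FlathCorvallis1979]; A. Borel, H. Jacquet, PSPM 33.1 (1979) §4.6 [BorelJacquet1979]; I. Bernstein, A. Zelevinsky,
Russian Math. Surveys 31 (1976) 2.16 [BernsteinZelevinsky1976]; J. Rogawski, Ann. of Math. Stud. 123 (1990), §14.5 p. 237 [Rogawski1990].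
-/

set_option autoImplicit false
-- the mandated namespace has the single-problem summit's repeated segment (`HodgeConjecture.HodgeConjecture`)
set_option linter.dupNamespace false

noncomputable section
namespace Summit.HodgeConjecture.HodgeConjecture.Cruxes.H413.F0P3LocalIsotypyFinOfRecord

open MeasureTheory NumberField IsDedekindDomain
open Literature.NumberTheory.Automorphic Literature.NumberTheory.Automorphic.UnitaryGroup
open ContRepresentation (AreUnitarilyEquivalent)
open Summit.HodgeConjecture.HodgeConjecture.Cruxes.H413.F0P3ClassTokensOfRecord (Cls cl rep rep_cl_areUnitarilyEquivalent)
open Summit.HodgeConjecture.HodgeConjecture.Cruxes.H413.F0P3ClassTokenChoice (clFinChoice)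
open Summit.HodgeConjecture.HodgeConjecture.Cruxes.H413.F0P3FinPartConstituentTransfer (smoothConstituents_iff_of_hasFinComponent)
open Summit.HodgeConjecture.HodgeConjecture.Cruxes.H413.F0P3FinComponentTokens

/-! ## §1 `HasFinComponent` along unitary equivalence -/

section Generic

variable {F E : Type} [Field F] [NumberField F] [Field E] [NumberField E] [Algebra F E] {c : E ≃ₐ[F] E} {N : ℕ}
  {J : Matrix (Fin N) (Fin N) E}
  {μ : Measure (adelicGroupData F E c N J).automorphicQuotient} [(adelicGroupData F E c N J).IsAutomorphicMeasure μ]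

/-- **`HasFinComponent σ` is transported along unitary equivalence of the closed subrepresentations**: compose the injective `U(J)(𝔸_{F,f})`-intertwiner
`σ → P` with the (injective, `U(J)(𝔸_F)`-equivariant) equivalence `P ≃ Q` (cf. ★ `HLiu418E1TwoFaces.hasFinComponent_of_equiv`, re-proved here to keep the import
cone small). [cite: BorelJacquet1979, §4.6] -/
theorem hasFinComponent_of_areUnitarilyEquivalent {P Q : DiscreteAutomorphicRep (adelicGroupData F E c N J) μ}
    (h : AreUnitarilyEquivalent P.space.toContRep Q.space.toContRep)
    {W : Type} [AddCommGroup W] [Module ℂ W] {σ : Representation ℂ (finAdelic F E c N J) W}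
    (hP : P.HasFinComponent σ) : Q.HasFinComponent σ := by
  obtain ⟨Φ, -⟩ := h
  obtain ⟨j, hj⟩ := hP
  let ΦI : P.finRep.IntertwiningMap Q.finRep :=
    LinearMap.intertwiningMap_of_isIntertwiningMap P.finRep Q.finRep Φ.toContIntertwiningMap.toContinuousLinearMap.toLinearMap
      fun k v => Φ.toContIntertwiningMap.isIntertwining (finAdelicToAdelic F E c N J k) v
  exact ⟨ΦI.comp j, fun a b hab => hj (EquivLike.injective Φ hab)⟩

/-- **The representative of record `rep (cl P)` has every finite component of `P`** (★ `rep_cl_areUnitarilyEquivalent`: `rep (cl P) ≃ P`). [cite: BorelJacquet1979, §4.6] -/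
theorem hasFinComponent_rep_cl (P : DiscreteAutomorphicRep (adelicGroupData F E c N J) μ)
    {W : Type} [AddCommGroup W] [Module ℂ W] {σ : Representation ℂ (finAdelic F E c N J) W} (hP : P.HasFinComponent σ) :
    (rep (adelicGroupData F E c N J) μ (cl (adelicGroupData F E c N J) μ P)).HasFinComponent σ :=
  hasFinComponent_of_areUnitarilyEquivalent (rep_cl_areUnitarilyEquivalent (adelicGroupData F E c N J) μ P).symm hP

end Generic

/-! ## §2 Law #22 at `𝔠₀` from the finite half of `hAF` -/

section CM

variable (L : Type) [Field L] [NumberField L] [IsCMField L] (H : Matrix (Fin 3) (Fin 3) L)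
  {μ : Measure (adelicGroupData (↥(maximalRealSubfield L)) L (IsCMField.complexConj L) 3 H).automorphicQuotient}
  [(adelicGroupData (↥(maximalRealSubfield L)) L (IsCMField.complexConj L) 3 H).IsAutomorphicMeasure μ]

/-- **Every constituent class of `P` at `v` IS the finite token of record**, for a discrete `P` with an irreducible ADMISSIBLE finite component `σ`: the constituent
classes of `P.finRep^∞|_{U(H)(L⁺_v)}` are those of `σ|_v` (★ T♭-core), a singleton (★ `isConstituentOf_comp_inclPlace_subsingleton`) containing the pull-back of
`clFinChoice (rep (cl P)) v` (★ `comap_clFinChoice_isConstituentOf_of_hasFinComponent` at `rep (cl P)`, which has the finite component `σ` by §1); `IrrClass.comap` along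
`localPiEquiv v` is injective (★ `IrrClass.comap_symm_comap`). [cite: FlathCorvallis1979, Thm. 3] [cite: Rogawski1990, §14.5 p. 237] -/
theorem eq_clFinChoice_of_isConstituentOf
    (P : DiscreteAutomorphicRep (adelicGroupData (↥(maximalRealSubfield L)) L (IsCMField.complexConj L) 3 H) μ)
    {W : Type} [AddCommGroup W] [Module ℂ W] {σ : Representation ℂ (finAdelic (↥(maximalRealSubfield L)) L (IsCMField.complexConj L) 3 H) W}
    (hirr : σ.IsIrreducible) (hadm : σ.IsAdmissible) (hP : P.HasFinComponent σ)
    (v : HeightOneSpectrum (𝓞 ↥(maximalRealSubfield L))) (c' : IrrClass ((cmDatum L 3 H).Local v))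
    (hc' : (IrrClass.comap (localPiEquiv L (IsCMField.complexConj L) 3 H v) c').IsConstituentOf
      (P.finRep.smoothPart.toRepresentation.comp (inclPlace (↥(maximalRealSubfield L)) L (IsCMField.complexConj L) 3 H v))) :
    c' = clFinChoice (rep (adelicGroupData (↥(maximalRealSubfield L)) L (IsCMField.complexConj L) 3 H) μ
      (cl (adelicGroupData (↥(maximalRealSubfield L)) L (IsCMField.complexConj L) 3 H) μ P)) v := by
  -- both classes, pulled back along `localPiEquiv v`, are constituents of `σ|_v`
  have h₁ := (smoothConstituents_iff_of_hasFinComponent P hirr hadm hP v _).mp hc'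
  have h₂ := comap_clFinChoice_isConstituentOf_of_hasFinComponent L H
    (rep (adelicGroupData (↥(maximalRealSubfield L)) L (IsCMField.complexConj L) 3 H) μ
      (cl (adelicGroupData (↥(maximalRealSubfield L)) L (IsCMField.complexConj L) 3 H) μ P)) hirr hadm (hasFinComponent_rep_cl P hP) v
  have h₃ := isConstituentOf_comp_inclPlace_subsingleton hirr hadm v h₁ h₂
  -- `comap` along an isomorphism is injective
  rw [← IrrClass.comap_symm_comap (localPiEquiv L (IsCMField.complexConj L) 3 H v) c', h₃, IrrClass.comap_symm_comap]

/-- **LAW `LocalIsotypyFin` (#22) AT `𝔠₀` FROM `hAF`** — token for token the body of `ClassificationKit.LocalIsotypyFin` (dossier v5 :551) at `clFin c v := clFinChoice (rep c) v`,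
`cl := cl (Gp L H) μ`: if every discrete automorphic `P` of `U(H)` has an irreducible ADMISSIBLE finite component (the finite half of «AutomorphicFlathAdmissible»,
RULING (V24)(d2)), then every constituent class of `P` at `v` equals `clFinChoice (rep (cl P)) v`. [cite: FlathCorvallis1979, Thm. 3] [cite: BorelJacquet1979, §4.6]
[cite: Rogawski1990, §14.5 p. 237] -/
theorem localIsotypyFin₀_of_hAF
    (hAF : ∀ P : DiscreteAutomorphicRep (adelicGroupData (↥(maximalRealSubfield L)) L (IsCMField.complexConj L) 3 H) μ,
      ∃ (W : Type) (_ : AddCommGroup W) (_ : Module ℂ W)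
        (σ : Representation ℂ (finAdelic (↥(maximalRealSubfield L)) L (IsCMField.complexConj L) 3 H) W),
        σ.IsIrreducible ∧ σ.IsAdmissible ∧ P.HasFinComponent σ) :
    ∀ (P : DiscreteAutomorphicRep (adelicGroupData (↥(maximalRealSubfield L)) L (IsCMField.complexConj L) 3 H) μ)
      (v : HeightOneSpectrum (𝓞 ↥(maximalRealSubfield L))) (c' : IrrClass ((cmDatum L 3 H).Local v)),
      (IrrClass.comap (localPiEquiv L (IsCMField.complexConj L) 3 H v) c').IsConstituentOf
          (P.finRep.smoothPart.toRepresentation.comp (inclPlace (↥(maximalRealSubfield L)) L (IsCMField.complexConj L) 3 H v)) →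
        c' = clFinChoice (rep (adelicGroupData (↥(maximalRealSubfield L)) L (IsCMField.complexConj L) 3 H) μ
          (cl (adelicGroupData (↥(maximalRealSubfield L)) L (IsCMField.complexConj L) 3 H) μ P)) v := by
  intro P v c' hc'
  obtain ⟨W, _, _, σ, hirr, hadm, hP⟩ := hAF P
  exact eq_clFinChoice_of_isConstituentOf L H P hirr hadm hP v c' hc'

end CM

end Summit.HodgeConjecture.HodgeConjecture.Cruxes.H413.F0P3LocalIsotypyFinOfRecord
end
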